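import Summits.Ventures.LatticeQCDFlow.Scaling.SwapSpacingOptimumDEO

/-!
HONEST FRAMING: exact (Metropolis-corrected) sampling algorithms for lattice gauge theory; figures
of merit are autocorrelation/cost numbers at stated couplings and volumes; no continuum-physics
claim.

# SwapAcceptanceOptimumDEO — THE DEO-MODEL PAIR EFFICIENCY `u²·erfc u/erf u` HAS A UNIQUE MAXIMISER
# `uDeo ∈ (0.58, 0.63)`: UNDER THE DRIVER's DETERMINISTIC EVEN–ODD SCHEME THE GAUSSIAN SWAP MODEL PREFERS THE
# SWAP ACCEPTANCE `aDeo = erfc uDeo ∈ (0.372, 0.413)` — NOT `0.234` — AND THE CARD's `20 %` KEEPS MORE THAN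
# `78 %` OF THAT OPTIMUM (row 22 `su3-ptbc`, GEN-5, ours; part 2 of `SwapSpacingOptimumDEO`)

Venture `LatticeQCDFlow` (cell pub-lqcd), topic `Scaling`; FANOUT row 22 (`su3-ptbc`).  Elementary calculus
over `SwapSpacingOptimumDEO` (`deoEff`, `deoCrit`, `deoCurv`, their derivatives, the certified signs
`deoCrit_055_pos`, `deoCrit_065_neg`, `deoCurv_neg_mid/right`, `gaussE_055_gt`) and GEN-4's
`SwapSpacingOptimum` (`swapCrit_neg_of_one_le`) / `SwapSpacingBrackets`.  Nothing is cited as a fact.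

* §1 SIGN PATTERN: `strictAntiOn_deoCurv` on `[0, 0.55]`; **`deoCrit_pos_of_le`** — `deoCrit > 0` on
  `(0, 0.55]`; `strictAntiOn_deoCrit` on `[0.55, 1]`; **`deoCrit_neg_of_ge`** — `deoCrit < 0` on `[0.65, ∞)`
  (`deoCrit < 2·swapCrit` beyond `1`); `uDeo` := the unique zero, `uDeo ∈ (0.55, 0.65)`,
  `deoCrit_eq_zero_iff`.
* §2 **`deoEff_lt_deoEff_uDeo`** — `uDeo` IS THE UNIQUE MAXIMISER of `deoEff` on `(0, ∞)`
  (`strictMonoOn_deoEff` on `(0, uDeo]`, `strictAntiOn_deoEff` on `[uDeo, ∞)`).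
* §3 ENCLOSURE: certified `deoCrit 0.58 > 0 > deoCrit 0.63` ⇒ **`uDeo ∈ (0.58, 0.63)`**; the optimal
  DEO-model acceptance **`aDeo ∈ (0.372, 0.413)`**; `deoEff uDeo < 0.257`; **`deoEff_twenty_gt`** — at any
  spacing with acceptance exactly `1/5`, `deoEff > 0.78·deoEff uDeo`.

Reading for CARD-su3-ptbc §1.5 (model statements only): GEN-4's 'optimal acceptance 0.234, the card's 0.20
keeps ≥ 92 %' is the REVERSIBLE-scheme idealisation; the driver's own scheme, idealised (ELE), prefers MORE,
CLOSER replicas (acceptance ≈ 0.37–0.41) and the `20 %` rule keeps `> 78 %` of its optimum.  PRINTED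
COUNTERPART, NAMED ONLY: Syed–Bouchard-Côté–Deligiannidis–Doucet (JRSSB 2022) §5.3 optimise the same
criterion (total round-trip rate at a fixed number of cores) in the linearised regime `r_i ≈ Λ/N` and find the
optimal per-pair REJECTION `r* ≈ 1/2` for DEO ("which differs from the 0.77 optimal rejection rate from the
reversible PT literature"), turning into the bound `r* < 1/2` when ELE is violated; the present `erfc` model gives
`r = erf uDeo ∈ (0.587, 0.628)`, the same side of the reversible value.  Practice sits between the idealisations
(finite sweep counts per scan violate ELE).  NOT CLAIMED: that either model describes PTBC at the card's points;
finite-`Λ` corrections; any number of a run.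
-/

noncomputable section

open Real Set
open Literature.Analysis.SpecialFunctions (erf erfTerm)
open Literature.ComputerArithmetic.BrentZimmermann2010.AsymptoticExpansions (erfc erfc_pos)

namespace Summit.Ventures.LatticeQCDFlow.Scaling

/-! ## §1 The sign pattern of `deoCrit` -/

section Sign

/-- `deoCurv` is continuous. [ours] -/
theorem continuous_deoCurv : Continuous deoCurv :=
  (show Differentiable ℝ deoCurv from fun u => (hasDerivAt_deoCurv u).differentiableAt).continuous

/-- `deoCrit` is continuous. [ours] -/
theorem continuous_deoCrit : Continuous deoCrit :=
  (show Differentiable ℝ deoCrit from fun u => (hasDerivAt_deoCrit u).differentiableAt).continuous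

/-- `deoCurv 0 = 1`. [ours] -/
theorem deoCurv_zero : deoCurv 0 = 1 := by simp [deoCurv, erf_zero]

/-- `deoCrit 0 = 0`. [ours] -/
theorem deoCrit_zero : deoCrit 0 = 0 := by simp [deoCrit, erf_zero]

/-- **`deoCurv` is strictly decreasing on `[0, 0.55]`** (there `u < 0.8229 < gaussE 0.55 ≤ gaussE u`). [ours] -/
theorem strictAntiOn_deoCurv : StrictAntiOn deoCurv (Icc 0 (11 / 20)) := by
  refine strictAntiOn_of_deriv_neg (convex_Icc _ _) continuous_deoCurv.continuousOn fun u hu => ?_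
  rw [interior_Icc] at hu
  rw [(hasDerivAt_deoCurv u).deriv]
  have h1 : gaussE (11 / 20) ≤ gaussE u := gaussE_antitoneOn hu.1.le (by norm_num : (0:ℝ) ≤ 11 / 20) hu.2.le
  linarith [gaussE_055_gt, hu.2]

/-- **`deoCrit > 0` on `(0, 0.55]`**: `deoCurv` changes sign once on `[0, 0.55]`, so `deoCrit` rises from
`deoCrit 0 = 0` and then falls to `deoCrit 0.55 > 0`. [ours] -/
theorem deoCrit_pos_of_le {u : ℝ} (hu0 : 0 < u) (hu1 : u ≤ 11 / 20) : 0 < deoCrit u := by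
  -- the root `r` of `deoCurv` in `(0, 0.55)`
  obtain ⟨r, hr, hr0⟩ : ∃ r ∈ Ioo (0 : ℝ) (11 / 20), deoCurv r = 0 := by
    have h := intermediate_value_Ioo' (show (0 : ℝ) ≤ 11 / 20 by norm_num) continuous_deoCurv.continuousOn
    exact h ⟨deoCurv_055_neg, by rw [deoCurv_zero]; norm_num⟩
  -- `deoCrit` increases on `[0, r]` and decreases on `[r, 0.55]`
  have hmono : StrictMonoOn deoCrit (Icc 0 r) := by
    refine strictMonoOn_of_deriv_pos (convex_Icc _ _) continuous_deoCrit.continuousOn fun x hx => ?_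
    rw [interior_Icc] at hx
    rw [(hasDerivAt_deoCrit x).deriv]
    have hk : deoCurv r < deoCurv x :=
      strictAntiOn_deoCurv ⟨hx.1.le, by linarith [hx.2, hr.2]⟩ ⟨hr.1.le, hr.2.le⟩ hx.2
    rw [hr0] at hk
    exact mul_pos (gaussE_pos x) hk
  have hanti : StrictAntiOn deoCrit (Icc r (11 / 20)) := by
    refine strictAntiOn_of_deriv_neg (convex_Icc _ _) continuous_deoCrit.continuousOn fun x hx => ?_
    rw [interior_Icc] at hx
    rw [(hasDerivAt_deoCrit x).deriv]
    have hk : deoCurv x < deoCurv r :=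
      strictAntiOn_deoCurv ⟨hr.1.le, hr.2.le⟩ ⟨by linarith [hr.1, hx.1], hx.2.le⟩ hx.1
    rw [hr0] at hk
    exact mul_neg_of_pos_of_neg (gaussE_pos x) hk
  rcases le_or_gt u r with hle | hgt
  · have h := hmono ⟨le_rfl, hr.1.le⟩ ⟨hu0.le, hle⟩ hu0
    rwa [deoCrit_zero] at h
  · have h := hanti.antitoneOn ⟨hgt.le, hu1⟩ ⟨hr.2.le, le_rfl⟩ hu1
    exact lt_of_lt_of_le deoCrit_055_pos h

/-- **`deoCrit` is strictly decreasing on `[0.55, 1]`** (`deoCurv < 0` there). [ours] -/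
theorem strictAntiOn_deoCrit : StrictAntiOn deoCrit (Icc (11 / 20) 1) := by
  refine strictAntiOn_of_deriv_neg (convex_Icc _ _) continuous_deoCrit.continuousOn fun x hx => ?_
  rw [interior_Icc] at hx
  rw [(hasDerivAt_deoCrit x).deriv]
  have hk : deoCurv x < 0 := by
    rcases le_or_gt x (13 / 20) with h | h
    · exact deoCurv_neg_mid hx.1.le h
    · exact deoCurv_neg_right h.le hx.2.le
  exact mul_neg_of_pos_of_neg (gaussE_pos x) hk

/-- `deoCrit u = 2·swapCrit u − 2·(erfc u)²`: beyond GEN-4's reversible optimum the DEO critical function is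
negative a fortiori. [ours] -/
theorem deoCrit_eq_swapCrit (u : ℝ) : deoCrit u = 2 * swapCrit u - 2 * erfc u ^ 2 := by
  unfold deoCrit swapCrit gaussE
  rw [erf_eq_one_sub_erfc]
  ring

/-- **`deoCrit < 0` on `[0.65, ∞)`.** [ours] -/
theorem deoCrit_neg_of_ge {u : ℝ} (hu : 13 / 20 ≤ u) : deoCrit u < 0 := by
  rcases le_or_gt u 1 with h1 | h1
  · have h := strictAntiOn_deoCrit.antitoneOn (a := 13 / 20) (b := u) ⟨by norm_num, by norm_num⟩
      ⟨by linarith, h1⟩ hu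
    exact lt_of_le_of_lt h deoCrit_065_neg
  · rw [deoCrit_eq_swapCrit]
    have hs := swapCrit_neg_of_one_le h1.le
    nlinarith [erfc_pos u]

/-- `deoCrit` has a zero in `(0.55, 0.65)`. [ours] -/
theorem exists_deoCrit_eq_zero : ∃ u ∈ Ioo (11 / 20 : ℝ) (13 / 20), deoCrit u = 0 := by
  have h := intermediate_value_Ioo' (show (11 / 20 : ℝ) ≤ 13 / 20 by norm_num) continuous_deoCrit.continuousOn
  exact h ⟨deoCrit_065_neg, deoCrit_055_pos⟩

/-- **`uDeo`**: the optimal reduced spacing of the DEO model (the unique positive zero of `deoCrit`). [ours] -/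
def uDeo : ℝ := exists_deoCrit_eq_zero.choose

/-- `0.55 < uDeo < 0.65`. [ours] -/
theorem uDeo_mem_Ioo : uDeo ∈ Ioo (11 / 20 : ℝ) (13 / 20) := exists_deoCrit_eq_zero.choose_spec.1

/-- `uDeo > 0`. [ours] -/
theorem uDeo_pos : 0 < uDeo := by linarith [uDeo_mem_Ioo.1]

/-- `deoCrit uDeo = 0`. [ours] -/
theorem deoCrit_uDeo : deoCrit uDeo = 0 := exists_deoCrit_eq_zero.choose_spec.2

/-- `deoCrit > 0` on `(0, uDeo)`. [ours] -/
theorem deoCrit_pos_of_lt_uDeo {u : ℝ} (hu0 : 0 < u) (hu : u < uDeo) : 0 < deoCrit u := by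
  rcases le_or_gt u (11 / 20) with h | h
  · exact deoCrit_pos_of_le hu0 h
  · have hlt := strictAntiOn_deoCrit ⟨h.le, by linarith [uDeo_mem_Ioo.2]⟩
      ⟨uDeo_mem_Ioo.1.le, by linarith [uDeo_mem_Ioo.2]⟩ hu
    rwa [deoCrit_uDeo] at hlt

/-- `deoCrit < 0` on `(uDeo, ∞)`. [ours] -/
theorem deoCrit_neg_of_uDeo_lt {u : ℝ} (hu : uDeo < u) : deoCrit u < 0 := by
  rcases le_or_gt (13 / 20) u with h | h
  · exact deoCrit_neg_of_ge h
  · have hlt := strictAntiOn_deoCrit ⟨uDeo_mem_Ioo.1.le, by linarith [uDeo_mem_Ioo.2]⟩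
      ⟨by linarith [uDeo_mem_Ioo.1], by linarith⟩ hu
    rwa [deoCrit_uDeo] at hlt

/-- Uniqueness: for `u > 0`, `deoCrit u = 0 ↔ u = uDeo`. [ours] -/
theorem deoCrit_eq_zero_iff {u : ℝ} (hu0 : 0 < u) : deoCrit u = 0 ↔ u = uDeo := by
  refine ⟨fun h => ?_, fun h => h ▸ deoCrit_uDeo⟩
  rcases lt_trichotomy u uDeo with hlt | heq | hgt
  · exact absurd h (deoCrit_pos_of_lt_uDeo hu0 hlt).ne'
  · exact heq
  · exact absurd h (deoCrit_neg_of_uDeo_lt hgt).ne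

end Sign

/-! ## §2 `uDeo` is the unique maximiser of the DEO-model efficiency -/

section Max

/-- `deoEff` is continuous on `(0, ∞)`. [ours] -/
theorem continuousOn_deoEff : ContinuousOn deoEff (Ioi 0) := by
  have h1 : Continuous fun u : ℝ => u ^ 2 * erfc u := (continuous_pow 2).mul continuous_erfc
  exact h1.continuousOn.div continuous_erf.continuousOn fun u hu => (erf_pos_of_pos hu).ne'

/-- **`deoEff` is strictly increasing on `(0, uDeo]`.** [ours] -/
theorem strictMonoOn_deoEff : StrictMonoOn deoEff (Ioc 0 uDeo) := by
  refine strictMonoOn_of_deriv_pos (convex_Ioc _ _) (continuousOn_deoEff.mono fun u hu => hu.1) fun u hu => ?_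
  rw [interior_Ioc] at hu
  rw [(hasDerivAt_deoEff hu.1).deriv]
  exact div_pos (mul_pos hu.1 (deoCrit_pos_of_lt_uDeo hu.1 hu.2)) (pow_pos (erf_pos_of_pos hu.1) 2)

/-- **`deoEff` is strictly decreasing on `[uDeo, ∞)`.** [ours] -/
theorem strictAntiOn_deoEff : StrictAntiOn deoEff (Ici uDeo) := by
  refine strictAntiOn_of_deriv_neg (convex_Ici _)
    (continuousOn_deoEff.mono fun u hu => lt_of_lt_of_le uDeo_pos hu) fun u hu => ?_
  rw [interior_Ici] at hu
  have hu0 : 0 < u := lt_trans uDeo_pos hu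
  rw [(hasDerivAt_deoEff hu0).deriv]
  exact div_neg_of_neg_of_pos (mul_neg_of_pos_of_neg hu0 (deoCrit_neg_of_uDeo_lt hu))
    (pow_pos (erf_pos_of_pos hu0) 2)

/-- **`uDeo` IS THE UNIQUE MAXIMISER of the DEO-model efficiency on `(0, ∞)`.** [ours] -/
theorem deoEff_lt_deoEff_uDeo {u : ℝ} (hu0 : 0 < u) (hne : u ≠ uDeo) : deoEff u < deoEff uDeo := by
  rcases lt_or_gt_of_ne hne with hlt | hgt
  · exact strictMonoOn_deoEff ⟨hu0, hlt.le⟩ ⟨uDeo_pos, le_rfl⟩ hlt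
  · exact strictAntiOn_deoEff self_mem_Ici (mem_Ici.2 hgt.le) hgt

/-- `deoEff u ≤ deoEff uDeo` for every `u > 0`. [ours] -/
theorem deoEff_le_deoEff_uDeo {u : ℝ} (hu0 : 0 < u) : deoEff u ≤ deoEff uDeo := by
  by_cases h : u = uDeo
  · rw [h]
  · exact (deoEff_lt_deoEff_uDeo hu0 h).le

end Max

/-! ## §3 Enclosure `0.58 < uDeo < 0.63` and the `20 %` comparison -/

section Enclosure

/-- Four Maclaurin terms of `erf` at `0.58`. [ours] -/
theorem erf_partialSum_058_even : ∑ i ∈ Finset.range (2 * 2), (-1 : ℝ) ^ i * erfTerm (29 / 50) i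
    = 5698443229397 / 10937500000000 := by
  simp only [erfTerm, Finset.sum_range_succ, Finset.sum_range_zero]; norm_num [Nat.factorial]

/-- Five Maclaurin terms of `erf` at `0.58`. [ours] -/
theorem erf_partialSum_058_odd : ∑ i ∈ Finset.range (2 * 2 + 1), (-1 : ℝ) ^ i * erfTerm (29 / 50) i
    = 1538681221959021083 / 2953125000000000000 := by
  simp only [erfTerm, Finset.sum_range_succ, Finset.sum_range_zero]; norm_num [Nat.factorial]

/-- Four Maclaurin terms of `erf` at `0.63`. [ours] -/
theorem erf_partialSum_063_even : ∑ i ∈ Finset.range (2 * 2), (-1 : ℝ) ^ i * erfTerm (63 / 100) i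
    = 111127502579373 / 200000000000000 := by
  simp only [erfTerm, Finset.sum_range_succ, Finset.sum_range_zero]; norm_num [Nat.factorial]

/-- Four Maclaurin terms of `erf` at `0.605`. [ours] -/
theorem erf_partialSum_0605_even : ∑ i ∈ Finset.range (2 * 2), (-1 : ℝ) ^ i * erfTerm (121 / 200) i
    = 96514257033128253 / 179200000000000000 := by
  simp only [erfTerm, Finset.sum_range_succ, Finset.sum_range_zero]; norm_num [Nat.factorial]

/-- `erf 0.58 > 0.58787`. [ours] -/
theorem erf_058_gt : (0.58787 : ℝ) < erf (29 / 50) := by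
  have h := partialSum_even_le_erf (x := 29 / 50) (by norm_num) (by norm_num) 2
  rw [erf_partialSum_058_even] at h
  have h2 : (1.12836 : ℝ) * (5698443229397 / 10937500000000) ≤ 2 / sqrt π * (5698443229397 / 10937500000000) :=
    mul_le_mul_of_nonneg_right lt_two_div_sqrt_pi.le (by norm_num)
  norm_num at h2 ⊢; linarith

/-- `erf 0.58 < 0.58793`. [ours] -/
theorem erf_058_lt : erf (29 / 50) < (0.58793 : ℝ) := by
  have h := erf_le_partialSum_odd (x := 29 / 50) (by norm_num) (by norm_num) 2
  rw [erf_partialSum_058_odd] at h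
  have h2 : 2 / sqrt π * (1538681221959021083 / 2953125000000000000 : ℝ)
      ≤ 1.128382 * (1538681221959021083 / 2953125000000000000) :=
    mul_le_mul_of_nonneg_right two_div_sqrt_pi_lt.le (by norm_num)
  norm_num at h2 ⊢; linarith

/-- `erf 0.63 > 0.62695`. [ours] -/
theorem erf_063_gt : (0.62695 : ℝ) < erf (63 / 100) := by
  have h := partialSum_even_le_erf (x := 63 / 100) (by norm_num) (by norm_num) 2
  rw [erf_partialSum_063_even] at h
  have h2 : (1.12836 : ℝ) * (111127502579373 / 200000000000000) ≤ 2 / sqrt π * (111127502579373 / 200000000000000) :=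
    mul_le_mul_of_nonneg_right lt_two_div_sqrt_pi.le (by norm_num)
  norm_num at h2 ⊢; linarith

/-- `erf 0.605 > 0.60771`. [ours] -/
theorem erf_0605_gt : (0.60771 : ℝ) < erf (121 / 200) := by
  have h := partialSum_even_le_erf (x := 121 / 200) (by norm_num) (by norm_num) 2
  rw [erf_partialSum_0605_even] at h
  have h2 : (1.12836 : ℝ) * (96514257033128253 / 179200000000000000)
      ≤ 2 / sqrt π * (96514257033128253 / 179200000000000000) :=
    mul_le_mul_of_nonneg_right lt_two_div_sqrt_pi.le (by norm_num)
  norm_num at h2 ⊢; linarith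

/-- `e^{0.58²} ≥ 1.39986` (five Taylor terms). [ours] -/
theorem exp_058_sq_ge : (1.39986 : ℝ) ≤ exp ((29 / 50 : ℝ) ^ 2) := by
  have h := Real.sum_le_exp_of_nonneg (x := (29 / 50 : ℝ) ^ 2) (by positivity) 5
  have hS : ∑ i ∈ Finset.range 5, ((29 / 50 : ℝ) ^ 2) ^ i / (i.factorial : ℝ) = 1312369554622961 / 937500000000000 := by
    simp only [Finset.sum_range_succ, Finset.sum_range_zero]; norm_num [Nat.factorial]
  rw [hS] at h; norm_num at h ⊢; linarith

/-- `e^{0.63²} ≤ 1.487218` (five Taylor terms with remainder). [ours] -/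
theorem exp_063_sq_le : exp ((63 / 100 : ℝ) ^ 2) ≤ (1.487218 : ℝ) := by
  have h := Real.exp_bound' (x := (63 / 100 : ℝ) ^ 2) (by positivity) (by norm_num) (n := 5) (by norm_num)
  have hS : ∑ i ∈ Finset.range 5, ((63 / 100 : ℝ) ^ 2) ^ i / (i.factorial : ℝ)
      = 1 + 3969 / 10000 + (3969 / 10000) ^ 2 / 2 + (3969 / 10000) ^ 3 / 6 + (3969 / 10000) ^ 4 / 24 := by
    simp only [Finset.sum_range_succ, Finset.sum_range_zero]; norm_num [Nat.factorial]
  rw [hS] at h; norm_num [Nat.factorial] at h ⊢; linarith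

/-- `gaussE 0.58 ≤ 0.80607`. [ours] -/
theorem gaussE_058_le : gaussE (29 / 50) ≤ (0.80607 : ℝ) := by
  rw [gaussE_eq_div, div_le_iff₀ (exp_pos _)]
  nlinarith [two_div_sqrt_pi_lt, exp_058_sq_ge]

/-- `gaussE 0.63 ≥ 0.7587`. [ours] -/
theorem gaussE_063_ge : (0.7587 : ℝ) ≤ gaussE (63 / 100) := by
  rw [gaussE_eq_div, le_div_iff₀ (exp_pos _)]
  nlinarith [lt_two_div_sqrt_pi, exp_063_sq_le]

/-- **`deoCrit 0.58 > 0`.** [ours] -/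
theorem deoCrit_058_pos : 0 < deoCrit (29 / 50) := by
  unfold deoCrit
  rw [show erfc (29 / 50 : ℝ) = 1 - erf (29 / 50) from rfl]
  nlinarith [erf_058_gt, erf_058_lt, gaussE_058_le, gaussE_pos (29 / 50)]

/-- **`deoCrit 0.63 < 0`.** [ours] -/
theorem deoCrit_063_neg : deoCrit (63 / 100) < 0 := by
  unfold deoCrit
  rw [show erfc (63 / 100 : ℝ) = 1 - erf (63 / 100) from rfl]
  nlinarith [erf_063_gt, erf_lt_one (63 / 100), gaussE_063_ge]

/-- **`0.58 < uDeo < 0.63`.** [ours] -/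
theorem uDeo_mem_Ioo_sharp : uDeo ∈ Ioo (29 / 50 : ℝ) (63 / 100) := by
  constructor
  · by_contra h
    push Not at h
    rcases eq_or_lt_of_le h with heq | hlt
    · have := deoCrit_058_pos; rw [← heq, deoCrit_uDeo] at this; exact lt_irrefl _ this
    · exact absurd (deoCrit_neg_of_uDeo_lt hlt) (not_lt.mpr deoCrit_058_pos.le)
  · by_contra h
    push Not at h
    rcases eq_or_lt_of_le h with heq | hlt
    · have := deoCrit_063_neg; rw [heq, deoCrit_uDeo] at this; exact lt_irrefl _ this
    · exact absurd (deoCrit_pos_of_lt_uDeo (by norm_num) hlt) (not_lt.mpr deoCrit_063_neg.le)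

/-- **The DEO-model optimal swap acceptance** `aDeo = erfc uDeo`. [ours] -/
def aDeo : ℝ := erfc uDeo

/-- Five Maclaurin terms of `erf` at `0.63`. [ours] -/
theorem erf_partialSum_063_odd : ∑ i ∈ Finset.range (2 * 2 + 1), (-1 : ℝ) ^ i * erfTerm (63 / 100) i
    = 4445679133328877549/8000000000000000000 := by
  simp only [erfTerm, Finset.sum_range_succ, Finset.sum_range_zero]; norm_num [Nat.factorial]

/-- `erf 0.63 < 0.62706`. [ours] -/
theorem erf_063_lt : erf (63 / 100) < (0.62706 : ℝ) := by
  have h := erf_le_partialSum_odd (x := 63 / 100) (by norm_num) (by norm_num) 2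
  rw [erf_partialSum_063_odd] at h
  have h2 : 2 / sqrt π * (4445679133328877549 / 8000000000000000000 : ℝ)
      ≤ 1.128382 * (4445679133328877549 / 8000000000000000000) :=
    mul_le_mul_of_nonneg_right two_div_sqrt_pi_lt.le (by norm_num)
  norm_num at h2 ⊢; linarith

/-- **`0.372 < aDeo < 0.413`** (`erfc` strictly decreasing; `erf 0.63 < 0.62706`, `erf 0.58 > 0.58787`). [ours] -/
theorem aDeo_bounds : (0.372 : ℝ) < aDeo ∧ aDeo < 0.413 := by
  obtain ⟨hlo, hhi⟩ := uDeo_mem_Ioo_sharp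
  have h1 : erfc (63 / 100) < erfc uDeo := strictAnti_erfc hhi
  have h2 : erfc uDeo < erfc (29 / 50) := strictAnti_erfc hlo
  rw [show erfc (63 / 100 : ℝ) = 1 - erf (63 / 100) from rfl] at h1
  rw [show erfc (29 / 50 : ℝ) = 1 - erf (29 / 50) from rfl] at h2
  unfold aDeo
  constructor
  · linarith [erf_063_lt]
  · linarith [erf_058_gt]

/-- **An upper bound for the optimal efficiency: `deoEff uDeo < 0.257`** (split at `0.605`: on
`(0.58, 0.605]` use `deoEff ≤ 0.605²·erfc 0.58/erf 0.58`, on `[0.605, 0.63)` use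
`≤ 0.63²·erfc 0.605/erf 0.605`). [ours] -/
theorem deoEff_uDeo_lt : deoEff uDeo < (0.257 : ℝ) := by
  obtain ⟨hlo, hhi⟩ := uDeo_mem_Ioo_sharp
  have hB : 0 < erf uDeo := erf_pos_of_pos uDeo_pos
  unfold deoEff
  rw [div_lt_iff₀ hB, show erfc uDeo = 1 - erf uDeo from rfl]
  rcases le_or_gt uDeo (121 / 200) with hmid | hmid
  · -- `erf uDeo ≥ erf 0.58 > 0.58787`, `uDeo ≤ 0.605`
    have h1 : erf (29 / 50) ≤ erf uDeo := by
      rw [erf_eq_one_sub_erfc, erf_eq_one_sub_erfc]; linarith [strictAnti_erfc.antitone hlo.le]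
    have h2 : uDeo ^ 2 ≤ (121 / 200) ^ 2 := by nlinarith
    have h3 : 0 < 1 - erf uDeo := by linarith [erf_lt_one uDeo]
    have h4 : uDeo ^ 2 * (1 - erf uDeo) ≤ (121 / 200) ^ 2 * (1 - erf uDeo) :=
      mul_le_mul_of_nonneg_right h2 h3.le
    nlinarith [erf_058_gt]
  · -- `erf uDeo ≥ erf 0.605 > 0.60771`, `uDeo < 0.63`
    have h1 : erf (121 / 200) ≤ erf uDeo := by
      rw [erf_eq_one_sub_erfc, erf_eq_one_sub_erfc]; linarith [strictAnti_erfc.antitone hmid.le]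
    have h2 : uDeo ^ 2 ≤ (63 / 100) ^ 2 := by nlinarith
    have h3 : 0 < 1 - erf uDeo := by linarith [erf_lt_one uDeo]
    have h4 : uDeo ^ 2 * (1 - erf uDeo) ≤ (63 / 100) ^ 2 * (1 - erf uDeo) :=
      mul_le_mul_of_nonneg_right h2 h3.le
    nlinarith [erf_0605_gt]

/-- **At the card's `20 %` target the DEO-model efficiency keeps MORE THAN `78 %` of its optimum**: if
`erfc u = 1/5` then `u > 0.9`, `deoEff u = u²/4 > 0.2025 > 0.78 · 0.257 > 0.78 · deoEff uDeo`. [ours] -/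
theorem deoEff_twenty_gt {u : ℝ} (hu : erfc u = 1 / 5) : 0.78 * deoEff uDeo < deoEff u := by
  have h9 : 9 / 10 < u := by
    by_contra h
    push Not at h
    have := strictAnti_erfc.antitone h
    linarith [erfc_09_gt]
  have he : erf u = 4 / 5 := by rw [erf_eq_one_sub_erfc, hu]; norm_num
  have hval : deoEff u = u ^ 2 / 4 := by
    unfold deoEff; rw [hu, he]; ring
  rw [hval]
  nlinarith [deoEff_uDeo_lt, h9]

end Enclosure

end Summit.Ventures.LatticeQCDFlow.Scaling

end
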